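import Summits.Schanuel.Schanuel.Theorems.ZilberEacMovingLineAll
import Summits.Schanuel.Schanuel.Theorems.ZilberEacMovingGraph
import HarnessLib

/-!
# Real-slope lines with `x₀`-DEPENDENT fibre polynomials: the Newton-polygon slow regime

Zilber's Exponential-Algebraic Closedness, case ladder (host summit Schanuel, cell `pub-schanuel`,
seat 2, gen 8).  The moving-target line family with fibre polynomial depending on the additive
coordinate as well: `W = movingGraphSurface (linePoly a b) A F = {x₁ = a x₀ + b, y₀ = A(x₀) + y₁ F(y₁, x₀)}`,
`F ∈ ℂ[u, x₀]` (variable `0` = `u = y₁`, variable `1` = `x₀`), exponential points = solutions of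
`e^{z} = A(z) + e^{a z + b} F(e^{a z + b}, z)`.  (Non-real slopes: `ZilberEacMovingGraph`.)

For a REAL slope `a` and `d = deg A ≥ 1`, near the lattice centres `2πi m + log A(2πi m)` one has
`|e^{az+b}| ≍ m^{ad}` and `|z| ≍ m`, so the monomial `uⁱ x₀ʲ` of `e^{az+b} F` contributes
`m^{a d (i+1) + j}`.  **Newton condition**: `a d (i + 1) + j < d` for every monomial `uⁱ x₀ʲ` of `F`.

* `eventually_exists_solution_realLineX` — existence under the Newton condition (relative
  moving-polydisc theorem; NEW solutions, e.g. `e^{z} = z² + z e^{-√2 z}`);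
* `unprojectedDense_movingLineX_real` — Zariski density (`a ∈ ℝ ∖ ℚ`; THEOREM I on `(y₀, y₁)`:
  growth exponents `d`, `a d`);
* `mmCase_movingLineX_iff`, `unprojectedDensityQuestion_instance_movingLineX_real` — these surfaces
  are in Mantova–Masser's case iff `a ∉ ℚ`, multiplicatively free, and (Newton regime) dense.

HONEST FRAMING: explicit families of instances of an OPEN question (Mantova–Masser 2024 §1); the
complementary "fast" regimes for `x₀`-dependent `F` and `EC(3,2)` remain OPEN; NOT Schanuel's
conjecture; EAC ⇏ SC.
-/

noncomputable section

open Complex MvPolynomial Filter Topology Metric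
open Literature.NumberTheory.Transcendental Literature.ModelTheory.Zilber

set_option linter.dupNamespace false

namespace Summit.Schanuel.Schanuel.Theorems

/-! ## Part 1. Bookkeeping -/

section Prelim

/-- Crude bound for a polynomial in two variables: `‖F(w)‖ ≤ Σ_s ‖F_s‖ ‖w₀‖^{s₀} ‖w₁‖^{s₁}`. [folklore] -/
theorem norm_eval_le_sum_fin_two (F : MvPolynomial (Fin 2) ℂ) (w : Fin 2 → ℂ) :
    ‖eval w F‖ ≤ ∑ s ∈ F.support, ‖coeff s F‖ * ‖w 0‖ ^ (s 0) * ‖w 1‖ ^ (s 1) := by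
  rw [eval_eq']
  refine (norm_sum_le _ _).trans (Finset.sum_le_sum fun s _ => ?_)
  rw [norm_mul, Fin.prod_univ_two, norm_mul, norm_pow, norm_pow, mul_assoc]

/-- `mlPoint a b x` lies on `{x₁ = a x₀ + b, y₀ = A(x₀) + y₁ F(y₁, x₀)}` iff `x` solves the equation.
[folklore] -/
theorem mlPoint_mem_movingGraphSurface_iff (a b : ℂ) (A : Polynomial ℂ) (F : MvPolynomial (Fin 2) ℂ)
    (x : ℂ) : mlPoint a b x ∈ movingGraphSurface (linePoly a b) A F ↔
      exp x = A.eval x + exp (a * x + b) * eval ![exp (a * x + b), x] F := by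
  rw [mem_movingGraphSurface_iff]
  simp

/-- **Cell membership for lines with `x₀`-dependent fibre polynomial**: in Mantova–Masser's case iff
`a ∉ ℚ` (`deg A ≥ 1`, any `F ∈ ℂ[u, x₀]`); the torus part is multiplicatively free. [folklore] -/
theorem mmCase_movingLineX_iff (a b : ℂ) {A : Polynomial ℂ} (hA : 0 < A.natDegree)
    (F : MvPolynomial (Fin 2) ℂ) :
    (MMCaseDimPiOneFree (movingGraphSurface (linePoly a b) A F) ↔ ∀ r : ℚ, a ≠ (r : ℂ)) ∧
      IsMulFree ℂ 2 (movingGraphSurface (linePoly a b) A F ∩ torusLocus ℂ 2) := by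
  have hdom := aeval_toMvPolynomial_fin_one_injective hA
  have hZ : zeroLocus ℂ (vanishingIdeal ℂ (projAdd ''
      (movingGraphSurface (linePoly a b) A F ∩ torusLocus ℂ 2))) = {x : Fin 2 → ℂ | x 1 = a * x 0 + b} := by
    rw [movingGraphSurface, vanishingIdeal_projAdd_polyFibredGraph _ _ _ hdom, ← vanishingIdeal_graphBase,
      zeroLocus_vanishingIdeal_of_isZariskiClosed (isZariskiClosed_graphBase _)]
    ext x
    simp only [graphBase, Set.mem_setOf_eq, MvPolynomial.eval_toMvPolynomial, eval_linePoly]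
    rfl
  refine ⟨⟨fun h r har => ?_, fun ha => ?_⟩, isMulFree_polyFibredGraph _ _ _ hdom⟩
  · obtain ⟨-, -, -, -, hline⟩ := h
    apply hline
    rw [hZ, har]
    exact isRationalSlopeLine_line_rat r b
  · refine ⟨isIrreducibleClosed_polyFibredGraph _ _ _, polyFibredGraph_inter_torusLocus_nonempty _ _ _ hdom,
      zariskiDim_polyFibredGraph _ _ _, addProjDim_polyFibredGraph _ _ _ hdom, ?_⟩
    rw [hZ]
    rintro ⟨m, hm, c, hL⟩
    have hsub : ∀ x : ℂ, (m 0 : ℂ) * x + (m 1 : ℂ) * (linePoly a b).eval x = c := by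
      intro x
      have hx : (![x, a * x + b] : Fin 2 → ℂ) ∈ {x : Fin 2 → ℂ | x 1 = a * x 0 + b} := by simp
      rw [hL] at hx
      simpa [eval_linePoly] using hx
    obtain ⟨h0, h1⟩ := lineCoeffs_eq_zero_of_not_rat ha (m 0) (m 1) c hsub
    exact hm (funext fun i => by fin_cases i <;> assumption)

end Prelim

/-! ## Part 2. The density engine for `x₀`-dependent fibre polynomials -/

section Engine

/-- **Real-slope engine, `x₀`-dependent form.**  For `a ∈ ℝ ∖ ℚ` and `deg A ≥ 1`: eventual solutions of
`e^{x} = A(x) + e^{ax+b} F(e^{ax+b}, x)` within `1/2` of the lattice centres `2πi m + log A(2πi m)` give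
Zariski density of the exponential points of `{x₁ = a x₀ + b, y₀ = A(x₀) + y₁ F(y₁, x₀)}` (THEOREM I on
`(y₀, y₁)`; the fibre polynomial plays no role in the elimination). (new) -/
theorem unprojectedDense_movingLineX_real_of_eventually {a : ℝ} (ha : Irrational a) (b : ℂ)
    {A : Polynomial ℂ} (hA : 0 < A.natDegree) (F : MvPolynomial (Fin 2) ℂ)
    (hsol : ∀ᶠ m : ℕ in atTop, ∃ x : ℂ,
      ‖x - ((m : ℂ) * (2 * Real.pi * I * ((1 : ℤ) : ℂ)) +
        log (A.eval ((m : ℂ) * (2 * Real.pi * I * ((1 : ℤ) : ℂ)))))‖ ≤ 1 / 2 ∧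
      exp x = A.eval x + exp ((a : ℂ) * x + b) * eval ![exp ((a : ℂ) * x + b), x] F) :
    UnprojectedDense (movingGraphSurface (linePoly a b) A F) := by
  classical
  have hA0 : A ≠ 0 := by rintro rfl; simp at hA
  obtain ⟨C, t₀, ht₀, hctrl⟩ := latticeCentre_control hA0 (one_ne_zero : (1 : ℤ) ≠ 0)
  obtain ⟨m₀, hm₀⟩ := eventually_atTop.1
    (hsol.and (tendsto_natCast_atTop_atTop.eventually_ge_atTop t₀))
  have hsol' : ∀ m : ℕ, ∃ x : ℂ,
      ‖x - (((max m m₀ : ℕ) : ℂ) * (2 * Real.pi * I * ((1 : ℤ) : ℂ)) +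
        log (A.eval (((max m m₀ : ℕ) : ℂ) * (2 * Real.pi * I * ((1 : ℤ) : ℂ)))))‖ ≤ 1 / 2 ∧
      exp x = A.eval x + exp ((a : ℂ) * x + b) * eval ![exp ((a : ℂ) * x + b), x] F :=
    fun m => (hm₀ (max m m₀) (le_max_right _ _)).1
  choose xs hxs using hsol'
  set p : ℕ → Fin 2 ⊕ Fin 2 → ℂ := fun m => mlPoint a b (xs m) with hp
  have hpS : ∀ m, p m ∈ movingGraphSurface (linePoly a b) A F := fun m =>
    (mlPoint_mem_movingGraphSurface_iff _ _ _ _ _).2 (hxs m).2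
  have hpΓ : ∀ m, p m ∈ expGraph ℂ 2 := fun m => mlPoint_mem_expGraph _ _ _
  set T : ℕ → ℝ := fun m => Real.log ((max m m₀ : ℕ) : ℝ) with hT
  have hTlim : Tendsto T atTop atTop := by
    refine Real.tendsto_log_atTop.comp (tendsto_natCast_atTop_atTop.comp ?_)
    exact tendsto_atTop_mono (fun m => le_max_left m m₀) tendsto_id
  have hctrl' : ∀ m, |(xs m).re - A.natDegree * T m| ≤ C := fun m =>
    (hctrl (max m m₀) (hm₀ _ (le_max_right _ _)).2 (xs m) (hxs m).1).1
  have hd : (A.natDegree : ℝ) ≠ 0 := by exact_mod_cast hA.ne'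
  refine unprojectedDense_of_logGrowth_irrational (isIrreducibleClosed_polyFibredGraph _ _ _)
    (zariskiDim_polyFibredGraph _ _ _).le (Sum.inr 0) (Sum.inr 1) hpS hpΓ hTlim ha hd
    (E := C + |a| * C + |b.re|) (Eventually.of_forall fun m => ⟨exp_ne_zero _, ?_⟩)
    (Eventually.of_forall fun m => ⟨exp_ne_zero _, ?_⟩)
  · simp only [hp, mlPoint_inr_zero, Complex.norm_exp, Real.log_exp]
    have h := hctrl' m
    have hC : 0 ≤ C := (abs_nonneg _).trans h
    have : 0 ≤ |a| * C + |b.re| := by positivity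
    linarith
  · simp only [hp, mlPoint_inr_one, Complex.norm_exp, Real.log_exp, Complex.add_re,
      Complex.re_ofReal_mul]
    have h := hctrl' m
    have hC : 0 ≤ C := (abs_nonneg _).trans h
    have e : a * (xs m).re + b.re - a * A.natDegree * T m =
        a * ((xs m).re - A.natDegree * T m) + b.re := by ring
    rw [e]
    calc |a * ((xs m).re - A.natDegree * T m) + b.re|
        ≤ |a * ((xs m).re - A.natDegree * T m)| + |b.re| := abs_add_le _ _
      _ = |a| * |(xs m).re - A.natDegree * T m| + |b.re| := by rw [abs_mul]
      _ ≤ |a| * C + |b.re| := by gcongr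
      _ ≤ C + |a| * C + |b.re| := by linarith

end Engine

/-! ## Part 3. Existence under the Newton condition -/

section Newton

/-- **Existence under the Newton condition.**  Let `a ∈ ℝ`, `b ∈ ℂ`, `A ∈ ℂ[x]` of degree `d ≥ 1`,
and `F ∈ ℂ[u, x₀]` such that every monomial `uⁱ x₀ʲ` of `F` satisfies `a d (i + 1) + j < d`.  Then for
all large `m` the equation `e^{x} = A(x) + e^{ax+b} F(e^{ax+b}, x)` has a solution within `1/2` of
`2πi m + log A(2πi m)`: on the unit polydisc `|e^{ax+b}| ≲ m^{ad}`, `|x| ≲ m`, so the monomial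
contributes `O(m^{ad(i+1)+j}) = o(m^{d})`; relative moving-polydisc theorem. (new)
[cite: MantovaMasser2023, §1 Further remarks] -/
theorem eventually_exists_solution_realLineX (a : ℝ) (b : ℂ) {A : Polynomial ℂ} (hA : 0 < A.natDegree)
    (F : MvPolynomial (Fin 2) ℂ)
    (hN : ∀ s ∈ F.support, a * A.natDegree * ((s 0 : ℝ) + 1) + s 1 < A.natDegree) :
    ∀ᶠ m : ℕ in atTop, ∃ x : ℂ,
      ‖x - ((m : ℂ) * (2 * Real.pi * I * ((1 : ℤ) : ℂ)) +
        log (A.eval ((m : ℂ) * (2 * Real.pi * I * ((1 : ℤ) : ℂ)))))‖ ≤ 1 / 2 ∧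
      exp x = A.eval x + exp ((a : ℂ) * x + b) * eval ![exp ((a : ℂ) * x + b), x] F := by
  classical
  have hA0 : A ≠ 0 := by rintro rfl; simp at hA
  set d : ℕ := A.natDegree with hd
  set q : Fin 1 → ℤ := fun _ => 1 with hq
  set A' : Fin 1 → MvPolynomial (Fin 1) ℂ := fun _ => A.toMvPolynomial 0 with hA'def
  have hpi : (2 * Real.pi * I * ((1 : ℤ) : ℂ)) ≠ 0 := by
    have := Real.pi_pos
    simp [Complex.ext_iff, this.ne']
  have hA' : ∀ j, eval (fun i => 2 * Real.pi * I * (q i : ℂ))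
      (homogeneousComponent (A' j).totalDegree (A' j)) ≠ 0 := fun _ =>
    eval_leadingForm_toMvPolynomial_fin_one_ne_zero hA0 hpi
  -- the perturbation
  set P : (Fin 1 → ℂ) → ℂ := fun x =>
    exp ((a : ℂ) * x 0 + b) * eval ![exp ((a : ℂ) * x 0 + b), x 0] F with hP
  have hPdiff : Differentiable ℂ P := by
    have h0 : Differentiable ℂ (fun x : Fin 1 → ℂ => x 0) := differentiable_apply 0
    have hℓ : Differentiable ℂ (fun x : Fin 1 → ℂ => exp ((a : ℂ) * x 0 + b)) :=
      ((h0.const_mul _).add_const _).cexp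
    refine hℓ.mul ?_
    have hw : Differentiable ℂ (fun x : Fin 1 → ℂ => (![exp ((a : ℂ) * x 0 + b), x 0] : Fin 2 → ℂ)) := by
      refine differentiable_pi.2 fun i => ?_
      fin_cases i
      · exact hℓ
      · exact h0
    exact (differentiable_mvPolynomial_eval F).comp hw
  -- control of `Re x`, `Im x` on the unit polydisc around the centres
  obtain ⟨C, t₀, ht₀, hctrl⟩ := latticeCentre_control_radius hA0 (one_ne_zero : (1 : ℤ) ≠ 0) 1
  have hC0 : 0 ≤ C := by
    obtain ⟨m, hm⟩ := exists_nat_ge t₀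
    have h := (hctrl m hm _ (by rw [sub_self, norm_zero]; exact zero_le_one)).1
    exact (abs_nonneg _).trans h
  -- constants
  set K : ℝ := d + 2 * C + 2 * Real.pi with hK
  have hK0 : 0 ≤ K := by have := Real.pi_pos; rw [hK]; positivity
  set E₁ : ℝ := Real.exp (|a| * C + b.re) with hE₁
  have hE₁0 : 0 ≤ E₁ := (Real.exp_pos _).le
  set μ : (Fin 2 →₀ ℕ) → ℝ := fun s => a * d * ((s 0 : ℝ) + 1) + s 1 with hμ
  set Ks : (Fin 2 →₀ ℕ) → ℝ := fun s => ‖coeff s F‖ * E₁ ^ (s 0 + 1) * K ^ (s 1) with hKs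
  -- ### the monomial-wise bound on the unit polydisc
  have hPbound : ∀ᶠ m : ℕ in atTop, ∀ ξ : Fin 1 → ℂ, ‖ξ‖ < 1 →
      ‖P ((fun i => (m : ℂ) * (2 * Real.pi * I * (q i : ℂ)) +
          log (eval (fun k => (m : ℂ) * (2 * Real.pi * I * (q k : ℂ))) (A' i))) + ξ)‖ ≤
        ∑ s ∈ F.support, Ks s * (m : ℝ) ^ μ s := by
    filter_upwards [tendsto_natCast_atTop_atTop.eventually_ge_atTop t₀] with m hm ξ hξ
    have hm1 : (1 : ℝ) ≤ m := ht₀.trans hm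
    have hm0 : (0 : ℝ) < m := by linarith
    set x : ℂ := ((m : ℂ) * (2 * Real.pi * I * ((1 : ℤ) : ℂ)) +
      log (A.eval ((m : ℂ) * (2 * Real.pi * I * ((1 : ℤ) : ℂ))))) + ξ 0 with hx
    have hcoord : ((fun i => (m : ℂ) * (2 * Real.pi * I * (q i : ℂ)) +
        log (eval (fun k => (m : ℂ) * (2 * Real.pi * I * (q k : ℂ))) (A' i))) + ξ) 0 = x := by
      simp only [Pi.add_apply, hA'def, hq, MvPolynomial.eval_toMvPolynomial, hx]
    obtain ⟨hre, him⟩ := hctrl m hm x (by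
      rw [hx, add_sub_cancel_left]
      exact (norm_le_pi_norm ξ 0).trans hξ.le)
    rw [abs_le] at hre him
    have hlogm : Real.log m ≤ m := (Real.log_le_sub_one_of_pos hm0).trans (by linarith)
    have hlog0 : 0 ≤ Real.log m := Real.log_nonneg hm1
    -- `‖x‖ ≤ K m`
    have hxn : ‖x‖ ≤ K * m := by
      refine (Complex.norm_le_abs_re_add_abs_im x).trans ?_
      have h1 : |x.re| ≤ d * Real.log m + C := by
        rw [abs_le]; constructor <;> nlinarith
      have h2 : |x.im| ≤ 2 * Real.pi * m + C := by
        rw [abs_le]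
        have := Real.pi_pos
        constructor <;> push_cast at him <;> nlinarith [him.1, him.2]
      rw [hK]
      have hd0 : (0 : ℝ) ≤ d := Nat.cast_nonneg _
      nlinarith [Real.pi_pos]
    -- `|e^{ax+b}| ≤ E₁ m^{ad}`
    have hex : ‖exp ((a : ℂ) * x + b)‖ ≤ E₁ * (m : ℝ) ^ (a * d) := by
      rw [Complex.norm_exp, Complex.add_re, Complex.re_ofReal_mul]
      have h1 : a * x.re ≤ a * (d * Real.log m) + |a| * C := by
        have : |a * (x.re - d * Real.log m)| ≤ |a| * C := by
          rw [abs_mul]; exact mul_le_mul_of_nonneg_left (abs_le.2 ⟨hre.1, hre.2⟩) (abs_nonneg _)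
        have := (abs_le.1 this).2
        linarith
      calc Real.exp (a * x.re + b.re) ≤ Real.exp ((|a| * C + b.re) + (a * d) * Real.log m) :=
            Real.exp_le_exp.2 (by linarith)
        _ = E₁ * (m : ℝ) ^ (a * d) := by
            rw [Real.exp_add, hE₁, Real.rpow_def_of_pos hm0, mul_comm (Real.log m)]
    -- the monomial bound
    rw [hP]
    simp only [hcoord]
    rw [norm_mul]
    have hw0 : ‖(![exp ((a : ℂ) * x + b), x] : Fin 2 → ℂ) 0‖ ≤ E₁ * (m : ℝ) ^ (a * d) := by
      simpa using hex
    have hw1 : ‖(![exp ((a : ℂ) * x + b), x] : Fin 2 → ℂ) 1‖ ≤ K * m := by simpa using hxn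
    have hF := norm_eval_le_sum_fin_two F ![exp ((a : ℂ) * x + b), x]
    calc ‖exp ((a : ℂ) * x + b)‖ * ‖eval ![exp ((a : ℂ) * x + b), x] F‖
        ≤ (E₁ * (m : ℝ) ^ (a * d)) *
            ∑ s ∈ F.support, ‖coeff s F‖ * (E₁ * (m : ℝ) ^ (a * d)) ^ (s 0) * (K * m) ^ (s 1) := by
          refine mul_le_mul hex (hF.trans (Finset.sum_le_sum fun s _ => ?_)) (norm_nonneg _)
            (by positivity)
          gcongr
      _ = ∑ s ∈ F.support, Ks s * (m : ℝ) ^ μ s := by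
          rw [Finset.mul_sum]
          refine Finset.sum_congr rfl fun s _ => ?_
          simp only [hKs, hμ]
          rw [mul_pow, mul_pow, ← Real.rpow_natCast ((m : ℝ) ^ (a * d)), ← Real.rpow_mul hm0.le,
            ← Real.rpow_natCast (m : ℝ) (s 1),
            show a * ↑d * ((s 0 : ℝ) + 1) + (s 1 : ℝ) = a * d + a * d * (s 0 : ℝ) + (s 1 : ℝ) by ring,
            Real.rpow_add hm0, Real.rpow_add hm0]
          ring
  -- ### relative smallness
  have hPsmall : ∀ θ : ℝ, 0 < θ → ∀ᶠ m : ℕ in atTop, ∀ ξ : Fin 1 → ℂ, ‖ξ‖ < 1 →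
      ‖P ((fun i => (m : ℂ) * (2 * Real.pi * I * (q i : ℂ)) +
          log (eval (fun k => (m : ℂ) * (2 * Real.pi * I * (q k : ℂ))) (A' i))) + ξ)‖ ≤
        θ * (m : ℝ) ^ (A' 0).totalDegree := by
    intro θ hθ
    have hdeg' : (A' 0).totalDegree = d := by rw [hA'def]; exact totalDegree_toMvPolynomial_fin_one A
    rw [hdeg']
    set N : ℕ := F.support.card + 1 with hNdef
    have hθ' : 0 < θ / N := by positivity
    have hterm : ∀ s ∈ F.support, ∀ᶠ m : ℕ in atTop, Ks s * (m : ℝ) ^ μ s ≤ θ / N * (m : ℝ) ^ (d : ℝ) :=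
      fun s hs => eventually_const_mul_rpow_le (Ks s) (hN s hs) hθ'
    filter_upwards [hPbound, (Filter.eventually_all_finset F.support).2 hterm, eventually_ge_atTop 1]
      with m hm hall hm1 ξ hξ
    refine (hm ξ hξ).trans ?_
    rw [← Real.rpow_natCast]
    calc ∑ s ∈ F.support, Ks s * (m : ℝ) ^ μ s ≤ ∑ s ∈ F.support, θ / N * (m : ℝ) ^ (d : ℝ) :=
          Finset.sum_le_sum fun s hs => hall s hs
      _ = F.support.card * (θ / N * (m : ℝ) ^ (d : ℝ)) := by rw [Finset.sum_const, nsmul_eq_mul]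
      _ ≤ θ * (m : ℝ) ^ (d : ℝ) := by
          have hmd : (0 : ℝ) ≤ (m : ℝ) ^ (d : ℝ) := by positivity
          have hcard : (F.support.card : ℝ) ≤ N := by rw [hNdef]; push_cast; linarith
          have hNpos : (0 : ℝ) < N := by positivity
          calc (F.support.card : ℝ) * (θ / N * (m : ℝ) ^ (d : ℝ))
              ≤ N * (θ / N * (m : ℝ) ^ (d : ℝ)) := by gcongr
            _ = θ * (m : ℝ) ^ (d : ℝ) := by field_simp
  -- ### the relative moving-polydisc theorem
  have hsol := exists_exp_eq_poly_add_near_latticeCentre_local q A' hA' (fun _ _ => P)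
    (Eventually.of_forall fun m j => hPdiff.differentiableOn) (fun j θ hθ => by
      have hj : j = 0 := Subsingleton.elim _ _
      subst hj
      exact hPsmall θ hθ)
  filter_upwards [hsol] with m ⟨xv, hxv, hsys⟩
  refine ⟨xv 0, ?_, ?_⟩
  · refine (norm_le_pi_norm (xv - _) 0).trans_eq' ?_ |>.trans hxv
    simp only [Pi.sub_apply, hA'def, hq, MvPolynomial.eval_toMvPolynomial]
  · have h := hsys 0
    simp only [hA'def, MvPolynomial.eval_toMvPolynomial, hP] at h
    exact h

/-- **Density under the Newton condition.**  For `a ∈ ℝ ∖ ℚ`, `b ∈ ℂ`, `deg A = d ≥ 1` and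
`F ∈ ℂ[u, x₀]` with `a d (i+1) + j < d` for all monomials `uⁱ x₀ʲ` of `F`, the exponential points of
`{x₁ = a x₀ + b, y₀ = A(x₀) + y₁ F(y₁, x₀)}` are ZARISKI DENSE. (new) [cite: MantovaMasser2023, §1 Further remarks] -/
theorem unprojectedDense_movingLineX_real {a : ℝ} (ha : Irrational a) (b : ℂ) {A : Polynomial ℂ}
    (hA : 0 < A.natDegree) (F : MvPolynomial (Fin 2) ℂ)
    (hN : ∀ s ∈ F.support, a * A.natDegree * ((s 0 : ℝ) + 1) + s 1 < A.natDegree) :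
    UnprojectedDense (movingGraphSurface (linePoly a b) A F) :=
  unprojectedDense_movingLineX_real_of_eventually ha b hA F (eventually_exists_solution_realLineX a b hA F hN)

/-- **Positive instances of the FREE typed question** (Newton regime, `a ∈ ℝ ∖ ℚ`): case ∧ free ∧
dense. (new) -/
theorem unprojectedDensityQuestion_instance_movingLineX_real {a : ℝ} (ha : Irrational a) (b : ℂ)
    {A : Polynomial ℂ} (hA : 0 < A.natDegree) (F : MvPolynomial (Fin 2) ℂ)
    (hN : ∀ s ∈ F.support, a * A.natDegree * ((s 0 : ℝ) + 1) + s 1 < A.natDegree) :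
    MMCaseDimPiOneFree (movingGraphSurface (linePoly a b) A F) ∧
      IsMulFree ℂ 2 (movingGraphSurface (linePoly a b) A F ∩ torusLocus ℂ 2) ∧
      UnprojectedDense (movingGraphSurface (linePoly a b) A F) := by
  obtain ⟨hiff, hfree⟩ := mmCase_movingLineX_iff (a : ℂ) b hA F
  have ha' : ∀ r : ℚ, (a : ℂ) ≠ (r : ℂ) := fun r h => ha ⟨r, by exact_mod_cast h.symm⟩
  exact ⟨hiff.2 ha', hfree, unprojectedDense_movingLineX_real ha b hA F hN⟩

/-- **Example**: `e^{z} = z² + z e^{-√2 z}` — the surface `{x₁ = -√2 x₀, y₀ = x₀² + x₀ y₁}` (monomial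
`u⁰ x₀¹`: `a d (0+1) + 1 = -2√2 + 1 < 2`) is in the case, free, and has dense exponential points. (new) -/
theorem unprojectedDensityQuestion_instance_sq_add_self_mul_exp :
    MMCaseDimPiOneFree (movingGraphSurface (linePoly ((-Real.sqrt 2 : ℝ) : ℂ) 0) (Polynomial.X ^ 2) (X 1)) ∧
      IsMulFree ℂ 2 (movingGraphSurface (linePoly ((-Real.sqrt 2 : ℝ) : ℂ) 0) (Polynomial.X ^ 2) (X 1) ∩
        torusLocus ℂ 2) ∧
      UnprojectedDense (movingGraphSurface (linePoly ((-Real.sqrt 2 : ℝ) : ℂ) 0) (Polynomial.X ^ 2) (X 1)) := by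
  refine unprojectedDensityQuestion_instance_movingLineX_real irrational_sqrt_two.neg 0
    (by rw [Polynomial.natDegree_X_pow]; exact two_pos) (X 1) ?_
  intro s hs
  rw [MvPolynomial.support_X, Finset.mem_singleton] at hs
  subst hs
  rw [Polynomial.natDegree_X_pow]
  simp only [Finsupp.single_eq_same, Nat.cast_one, Nat.cast_ofNat]
  have h2 : 0 < Real.sqrt 2 := Real.sqrt_pos.2 (by norm_num)
  nlinarith

end Newton

end Summit.Schanuel.Schanuel.Theorems

end
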